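import Mathlib
import HarnessLib
import Literature.Algebra.Polynomial.HyperbolicPolynomialCurveRootCluster
import Summits.ValiantsHypothesis.ValiantsHypothesis.Theorems.LacunarySymmetroidMatrixDescartesOsculationLawPeelCurve
import Summits.ValiantsHypothesis.ValiantsHypothesis.Theorems.LacunarySymmetroidMatrixDescartesOsculationLawPeelRankThreeUp
import Summits.ValiantsHypothesis.ValiantsHypothesis.Theorems.LacunarySymmetroidMatrixDescartesOsculationLawPeelSortedRoots

/-!
# ValiantsHypothesis / LacunarySymmetroid — crux `MatrixDescartes` (stmt-ValiantsHypothesis-18050, V1),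
# line `Cruxes/MatrixDescartes/Lines/osculation_law.lean` («osculation-law»), stub `stub_recursion` (ROUTE′):
# THE CROSSING-TOLERANT PEEL INEQUALITY, CURVE FORM (NOTE-p7g13-18050-GP-density-sizing.md §5)

The landed peel inequality (`peelInequality_rank_all`) needs the general-position hypothesis «`∂_bΦ ≠ 0` on the osculation set»,
which forbids every crossing of eigenvalue branches in the quadrant — the one condition that makes the density residue of
`stub_recursion` XL.  THIS FILE proves the peel count WITHOUT it, for MONIC coefficient-form curves `Φ = Σ_{k≤m} X₁^k·ι(a_k)`,
`a_m = 1` (the recursion's nodes at the splitting `(m, 0)`, where `Φ(t,·) = det(G(t) + b·1)`):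

  `Z₊mult(Σ_k (cX^N)^k a_k) ≤ 2m·#osc + 2m + 2·Z₊mult(a₀)`     (osc finite, arc avoidance `p 1 ≠ c·p 0^N` only).

Branches = the SORTED roots `β₀ ≤ ⋯ ≤ β_{m−1}` of the fibre (`…PeelSortedRoots.exists_sortedRoots`: continuous on `t > 0`; they
touch at crossings but never cross).  Every positive root of the inserted letter lies on some `β_k` (cover,
`card_le_sum_card_of_cover`).  For branch `k`, CUTS = {positive zeros `ω` of `a₀` with `β_k(ω) = 0`} ∪ {abscissae of osculation
points ON `β_k`}; on a cut-free arc `β_k` has constant sign; if positive, every point of the arc is OFF osc, hence a SIMPLE root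
(`eval_logHessian_eq_zero_of_pderiv_one_eq_zero`: a multiple root is a fold or a flex, either way `H = 0`), so the branch is smooth
there (`hasDerivAt_of_solution_of_simple`, local implicit branch) and the ENGINE `card_roots_filter_branchArc_le_two` allows ≤ 2
roots; the pigeonhole `card_le_mul_card_cuts_succ` gives ≤ `2·(#cuts_k + 1)` per branch.  Summing: `Σ_k #{ω : β_k(ω) = 0}` counts,
over each zero `ω` of `a₀`, the multiplicity of `0` in the fibre `P ω` (sorted roots enumerate with multiplicity), which is
`≤ ord_ω a₀` by val-lit-p9 g2's `AKLM.rootMultiplicity_zero_le_rootMultiplicity_coeff`; and each osculation point lies on ≤ m branches.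

* `eval_logHessian_eq_zero_of_pderiv_one_eq_zero`, `hasDerivAt_of_solution_of_simple`, **`peel_curve_prime`**.

Honest framing: a helper THEOREM toward the OPEN stub `stub_recursion` (its general-position residue); the osculation LAW,
`MatrixDescartes` (18050) and `VP ≠ VNP` are NOT proved.  No definitions, no named facts.
-/

-- `Summit.ValiantsHypothesis.ValiantsHypothesis.…` is the tree's mandated single-conjunct layout (Sub = Summit).
set_option linter.dupNamespace false

noncomputable section

namespace Summit.ValiantsHypothesis.ValiantsHypothesis.Theorems.LacunarySymmetroidMatrixDescartes

open Polynomial Set Filter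
open MvPolynomial (pderiv)
open scoped BigOperators Topology

namespace OsculationPeel

/-- **A multiple root of a hyperbolic fibre is an osculation point**: `Φ = ∂_bΦ = 0` at `(t₀, b₀)`, `t₀ > 0`, forces `H(Φ) = 0`
there (an exactly-double root is a fold, `no_fold_hyperbolic`; higher multiplicity is a flex). [folklore] -/
theorem eval_logHessian_eq_zero_of_pderiv_one_eq_zero (Φ : MvPolynomial (Fin 2) ℝ) (P : ℝ → ℝ[X])
    (hP : ∀ t b, (P t).eval b = MvPolynomial.eval ![t, b] Φ) (hsplit : ∀ t, 0 < t → (P t).Splits)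
    {t₀ b₀ : ℝ} (ht₀ : 0 < t₀) (hΦ : MvPolynomial.eval ![t₀, b₀] Φ = 0)
    (hΦ1 : MvPolynomial.eval ![t₀, b₀] (pderiv 1 Φ) = 0) :
    MvPolynomial.eval ![t₀, b₀]
      (MvPolynomial.X 0 * MvPolynomial.pderiv 0 (MvPolynomial.X 0 * MvPolynomial.pderiv 0 Φ)
            * (MvPolynomial.X 1 * MvPolynomial.pderiv 1 Φ) ^ 2
          - 2 * (MvPolynomial.X 0 * MvPolynomial.pderiv 0 (MvPolynomial.X 1 * MvPolynomial.pderiv 1 Φ))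
            * (MvPolynomial.X 0 * MvPolynomial.pderiv 0 Φ) * (MvPolynomial.X 1 * MvPolynomial.pderiv 1 Φ)
          + MvPolynomial.X 1 * MvPolynomial.pderiv 1 (MvPolynomial.X 1 * MvPolynomial.pderiv 1 Φ)
            * (MvPolynomial.X 0 * MvPolynomial.pderiv 0 Φ) ^ 2) = 0 := by
  by_cases h11 : MvPolynomial.eval ![t₀, b₀] (pderiv 1 (pderiv 1 Φ)) = 0
  · exact eval_logHessian_eq_zero_of_flex Φ _ hΦ1 h11
  · exact eval_logHessian_eq_zero_of_singular Φ _ (no_fold_hyperbolic Φ P hP hsplit ht₀ hΦ hΦ1 h11) hΦ1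

/-- **Regularity without global general position**: a continuous solution on `(α, ω)` along which `∂_bΦ ≠ 0` is smooth, with
the ENGINE's derivative data. [folklore] -/
theorem hasDerivAt_of_solution_of_simple (Φ : MvPolynomial (Fin 2) ℝ) {α ω : ℝ} {β : ℝ → ℝ}
    (hcont : ContinuousOn β (Ioo α ω)) (hsol : ∀ t ∈ Ioo α ω, MvPolynomial.eval ![t, β t] Φ = 0)
    (hΦb : ∀ t ∈ Ioo α ω, MvPolynomial.eval ![t, β t] (pderiv 1 Φ) ≠ 0) :
    ∀ s ∈ Ioo α ω, HasDerivAt β (deriv β s) s ∧ HasDerivAt (deriv β) (deriv (deriv β) s) s := by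
  have hcd : ∀ t ∈ Ioo α ω, ContDiffAt ℝ ⊤ β t := by
    intro t ht
    obtain ⟨ψ, -, hψcd, -, hU⟩ := exists_local_branch Φ (hsol t ht) (hΦb t ht)
    have hβc : ContinuousAt β t := (hcont t ht).continuousAt (Ioo_mem_nhds ht.1 ht.2)
    have hcurve : Tendsto (fun u => ((u, β u) : ℝ × ℝ)) (𝓝 t) (𝓝 (t, β t)) :=
      (continuous_id.tendsto t).prodMk_nhds hβc
    have h1 := hcurve.eventually hU
    have h2 : ∀ᶠ u in 𝓝 t, MvPolynomial.eval ![u, β u] Φ = 0 :=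
      mem_of_superset (Ioo_mem_nhds ht.1 ht.2) fun u hu => hsol u hu
    have heq : β =ᶠ[𝓝 t] ψ := by
      filter_upwards [h1, h2] with u hu hu0
      exact (hu.1 hu0).symm
    exact hψcd.congr_of_eventuallyEq heq
  have hon : ContDiffOn ℝ ⊤ β (Ioo α ω) := fun t ht => (hcd t ht).contDiffWithinAt
  have hon' : ContDiffOn ℝ ⊤ (deriv β) (Ioo α ω) := hon.deriv_of_isOpen isOpen_Ioo (by simp)
  intro s hs
  have hnhds : Ioo α ω ∈ 𝓝 s := Ioo_mem_nhds hs.1 hs.2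
  exact ⟨((hon.differentiableOn (by simp)).differentiableAt hnhds).hasDerivAt,
    ((hon'.differentiableOn (by simp)).differentiableAt hnhds).hasDerivAt⟩

/-- **The crossing-tolerant peel inequality, curve form** (monic coefficient form, `a_m = 1`):
`Z₊mult(Σ_k (cX^N)^k a_k) ≤ 2m·#osc + 2m + 2·Z₊mult(a₀)` under «osc finite» and arc avoidance only. [folklore] -/
theorem peel_curve_prime (m : ℕ) (a : ℕ → ℝ[X]) (Φ : MvPolynomial (Fin 2) ℝ)
    (hΦ : Φ = ∑ k ∈ Finset.range (m + 1), (MvPolynomial.X 1 : MvPolynomial (Fin 2) ℝ) ^ k *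
      Polynomial.aeval (MvPolynomial.X 0 : MvPolynomial (Fin 2) ℝ) (a k))
    (htop : a m = 1)
    (hsplit : ∀ t, 0 < t → (∑ k ∈ Finset.range (m + 1), (X : ℝ[X]) ^ k * Polynomial.C ((a k).eval t)).Splits)
    (hfin : {p : Fin 2 → ℝ | 0 < p 0 ∧ 0 < p 1 ∧ MvPolynomial.eval p Φ = 0 ∧
      MvPolynomial.eval p
        (MvPolynomial.X 0 * MvPolynomial.pderiv 0 (MvPolynomial.X 0 * MvPolynomial.pderiv 0 Φ)
            * (MvPolynomial.X 1 * MvPolynomial.pderiv 1 Φ) ^ 2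
          - 2 * (MvPolynomial.X 0 * MvPolynomial.pderiv 0 (MvPolynomial.X 1 * MvPolynomial.pderiv 1 Φ))
            * (MvPolynomial.X 0 * MvPolynomial.pderiv 0 Φ) * (MvPolynomial.X 1 * MvPolynomial.pderiv 1 Φ)
          + MvPolynomial.X 1 * MvPolynomial.pderiv 1 (MvPolynomial.X 1 * MvPolynomial.pderiv 1 Φ)
            * (MvPolynomial.X 0 * MvPolynomial.pderiv 0 Φ) ^ 2) = 0}.Finite)
    (c : ℝ) (N : ℕ) (hc : 0 < c)
    (hgp : ∀ p ∈ {p : Fin 2 → ℝ | 0 < p 0 ∧ 0 < p 1 ∧ MvPolynomial.eval p Φ = 0 ∧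
      MvPolynomial.eval p
        (MvPolynomial.X 0 * MvPolynomial.pderiv 0 (MvPolynomial.X 0 * MvPolynomial.pderiv 0 Φ)
            * (MvPolynomial.X 1 * MvPolynomial.pderiv 1 Φ) ^ 2
          - 2 * (MvPolynomial.X 0 * MvPolynomial.pderiv 0 (MvPolynomial.X 1 * MvPolynomial.pderiv 1 Φ))
            * (MvPolynomial.X 0 * MvPolynomial.pderiv 0 Φ) * (MvPolynomial.X 1 * MvPolynomial.pderiv 1 Φ)
          + MvPolynomial.X 1 * MvPolynomial.pderiv 1 (MvPolynomial.X 1 * MvPolynomial.pderiv 1 Φ)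
            * (MvPolynomial.X 0 * MvPolynomial.pderiv 0 Φ) ^ 2) = 0},
        p 1 ≠ c * p 0 ^ N)
    (ha0 : a 0 ≠ 0) :
    Multiset.card ((∑ k ∈ Finset.range (m + 1), (Polynomial.C c * (X : ℝ[X]) ^ N) ^ k * a k).roots.filter
        (fun t => 0 < t)) ≤
      2 * m * {p : Fin 2 → ℝ | 0 < p 0 ∧ 0 < p 1 ∧ MvPolynomial.eval p Φ = 0 ∧
      MvPolynomial.eval p
        (MvPolynomial.X 0 * MvPolynomial.pderiv 0 (MvPolynomial.X 0 * MvPolynomial.pderiv 0 Φ)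
            * (MvPolynomial.X 1 * MvPolynomial.pderiv 1 Φ) ^ 2
          - 2 * (MvPolynomial.X 0 * MvPolynomial.pderiv 0 (MvPolynomial.X 1 * MvPolynomial.pderiv 1 Φ))
            * (MvPolynomial.X 0 * MvPolynomial.pderiv 0 Φ) * (MvPolynomial.X 1 * MvPolynomial.pderiv 1 Φ)
          + MvPolynomial.X 1 * MvPolynomial.pderiv 1 (MvPolynomial.X 1 * MvPolynomial.pderiv 1 Φ)
            * (MvPolynomial.X 0 * MvPolynomial.pderiv 0 Φ) ^ 2) = 0}.ncard + 2 * m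
        + 2 * Multiset.card ((a 0).roots.filter (fun t => 0 < t)) := by
  classical
  -- the vertical family, the inserted letter
  set P : ℝ → ℝ[X] := fun t => ∑ k ∈ Finset.range (m + 1), (X : ℝ[X]) ^ k * Polynomial.C ((a k).eval t) with hPdef
  have hP : ∀ t b, (P t).eval b = MvPolynomial.eval ![t, b] Φ := fun t b => by rw [hΦ]; exact eval_coeffForm m a t b
  set g : ℝ[X] := ∑ k ∈ Finset.range (m + 1), (Polynomial.C c * (X : ℝ[X]) ^ N) ^ k * a k with hgdef
  have hg : ∀ t, g.eval t = MvPolynomial.eval ![t, c * t ^ N] Φ := fun t => by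
    rw [hΦ]; exact eval_insertedCoeffForm m a c N t
  -- monic of degree `m`, coefficients continuous
  have hcoefP : ∀ t i, (P t).coeff i = if i < m + 1 then (a i).eval t else 0 := fun t i => coeff_coeffForm m a t i
  have hmonic : ∀ t, (P t).Monic := fun t =>
    monic_of_natDegree_le_of_coeff_eq_one m (natDegree_coeffForm_le m a t)
      (by rw [hcoefP, if_pos (Nat.lt_succ_self m), htop, eval_one])
  have hdegP : ∀ t, (P t).natDegree = m := fun t =>
    le_antisymm (natDegree_coeffForm_le m a t)
      (le_natDegree_of_ne_zero (by rw [hcoefP, if_pos (Nat.lt_succ_self m), htop, eval_one]; exact one_ne_zero))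
  have hcoefcont : ∀ k, ContinuousOn (fun t => (P t).coeff k) (Ioi 0) := by
    intro k
    by_cases hk : k < m + 1
    · have : (fun t => (P t).coeff k) = fun t => (a k).eval t := funext fun t => by rw [hcoefP, if_pos hk]
      rw [this]; exact (a k).continuous.continuousOn
    · have : (fun t => (P t).coeff k) = fun _ => (0 : ℝ) := funext fun t => by rw [hcoefP, if_neg hk]
      rw [this]; exact continuousOn_const
  have hP0 : ∀ t, P t ≠ 0 := fun t => (hmonic t).ne_zero
  -- sorted roots
  obtain ⟨β, hroots, -, hisroot, hcontβ⟩ := exists_sortedRoots P (Ioi 0) m (fun t _ => hmonic t) (fun t _ => hdegP t)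
    (fun t ht => hsplit t ht) hcoefcont
  have hsolβ : ∀ k, k < m → ∀ t, 0 < t → MvPolynomial.eval ![t, β k t] Φ = 0 := fun k hk t ht => by
    rw [← hP]; exact hisroot t ht k hk
  -- zeros of a branch are zeros of `a₀`
  have hzero : ∀ k, k < m → ∀ ω, 0 < ω → β k ω = 0 → (a 0).IsRoot ω := by
    intro k hk ω hω h0
    have h := hisroot ω hω k hk
    rw [h0, IsRoot, eval_zero_coeffForm] at h
    exact h
  by_cases hg0 : g = 0
  · rw [hg0, roots_zero, Multiset.filter_zero, Multiset.card_zero]; exact Nat.zero_le _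
  -- the branch multisets and the cover
  set M : Multiset ℝ := g.roots.filter (fun t => 0 < t) with hM
  set T : ℕ → Multiset ℝ := fun k => g.roots.filter (fun t => 0 < t ∧ β k t = c * t ^ N) with hT
  have hcover : Multiset.card M ≤ ∑ k ∈ Finset.range m, Multiset.card (T k) := by
    refine card_le_sum_card_of_cover M (Finset.range m) T fun x hx => ?_
    obtain ⟨hxr, hx0⟩ := Multiset.mem_filter.1 hx
    have hrootP : (c * x ^ N) ∈ (P x).roots := by
      rw [mem_roots (hP0 x), IsRoot, hP, ← hg]
      exact (mem_roots hg0).1 hxr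
    rw [hroots x hx0, Multiset.mem_map] at hrootP
    obtain ⟨k, hk, hkx⟩ := hrootP
    refine ⟨k, hk, le_of_eq ?_⟩
    rw [hM, hT, Multiset.count_filter_of_pos hx0, Multiset.count_filter_of_pos ⟨hx0, hkx⟩]
  -- the cuts of branch `k`
  set A : Finset ℝ := ((a 0).roots.toFinset).filter (fun ω => 0 < ω) with hA
  set Z : ℕ → Finset ℝ := fun k => A.filter (fun ω => β k ω = 0) with hZ
  set O : ℕ → Finset (Fin 2 → ℝ) := fun k => hfin.toFinset.filter (fun p => p 1 = β k (p 0)) with hO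
  have hbranch : ∀ k, k < m → Multiset.card (T k) ≤ 2 * ((Z k ∪ (O k).image (fun p => p 0)).card + 1) := by
    intro k hk
    refine card_le_mul_card_cuts_succ (T k) _ 2 (fun t ht => (Multiset.mem_filter.1 ht).2.1) (fun t ht => ?_)
      (fun L U hL hfree => ?_)
    · -- roots avoid the cuts
      obtain ⟨-, ht0, htβ⟩ := Multiset.mem_filter.1 ht
      intro hmem
      rcases Finset.mem_union.1 hmem with hz | ho
      · have h0 : β k t = 0 := (Finset.mem_filter.1 hz).2
        rw [h0] at htβ
        have : 0 < c * t ^ N := by positivity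
        linarith
      · obtain ⟨p, hp, hp0⟩ := Finset.mem_image.1 ho
        obtain ⟨hposc, hp1⟩ := Finset.mem_filter.1 hp
        refine hgp p ((Set.Finite.mem_toFinset hfin).1 hposc) ?_
        rw [hp1, hp0, htβ]
    · -- a cut-free arc `(L, U)`, `L ≥ 0`
      have hIoi : ∀ s ∈ Ioo L U, 0 < s := fun s hs => hL.trans_lt hs.1
      have hcontk : ContinuousOn (β k) (Ioo L U) := (hcontβ k hk).mono fun s hs => hIoi s hs
      by_cases hneg : ∃ s ∈ Ioo L U, β k s ≤ 0
      · -- the branch is not positive somewhere: then it carries NO root on the arc (a sign change would be a cut)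
        obtain ⟨s, hs, hs0⟩ := hneg
        suffices h : (T k).filter (fun t => L < t ∧ t < U) = 0 by
          rw [h, Multiset.card_zero]; exact Nat.zero_le _
        refine Multiset.filter_eq_nil.2 fun t ht hLU => ?_
        obtain ⟨-, ht0, htβ⟩ := Multiset.mem_filter.1 ht
        have htpos : 0 < β k t := by rw [htβ]; positivity
        -- IVT between `s` and `t` inside `(L, U)`
        obtain ⟨ω, hω, hω0⟩ : ∃ ω ∈ Ioo L U, β k ω = 0 := by
          rcases le_total s t with hst | hts
          · have hsub : Icc s t ⊆ Ioo L U := fun u hu => ⟨hs.1.trans_le hu.1, hu.2.trans_lt hLU.2⟩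
            have hmem : (0 : ℝ) ∈ Icc (β k s) (β k t) := ⟨hs0, htpos.le⟩
            obtain ⟨ω, hω, hω0⟩ := intermediate_value_Icc hst (hcontk.mono hsub) hmem
            exact ⟨ω, hsub hω, hω0⟩
          · have hsub : Icc t s ⊆ Ioo L U := fun u hu => ⟨hLU.1.trans_le hu.1, hu.2.trans_lt hs.2⟩
            have hmem : (0 : ℝ) ∈ Icc (β k s) (β k t) := ⟨hs0, htpos.le⟩
            obtain ⟨ω, hω, hω0⟩ := intermediate_value_Icc' hts (hcontk.mono hsub) hmem
            exact ⟨ω, hsub hω, hω0⟩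
        have hωA : ω ∈ Z k := by
          refine Finset.mem_filter.2 ⟨Finset.mem_filter.2 ⟨?_, hIoi ω hω⟩, hω0⟩
          exact Multiset.mem_toFinset.2 ((mem_roots ha0).2 (hzero k hk ω (hIoi ω hω) hω0))
        exact hfree ω (Finset.mem_union.2 (Or.inl hωA)) hω
      · -- the branch is positive on the arc and free of osculation: the ENGINE
        push Not at hneg
        have hposk : ∀ s ∈ Ioo L U, 0 < β k s := fun s hs => hneg s hs
        have hsolk : ∀ s ∈ Ioo L U, MvPolynomial.eval ![s, β k s] Φ = 0 := fun s hs => hsolβ k hk s (hIoi s hs)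
        -- no osculation point of the branch inside the arc
        have hnot_osc : ∀ s ∈ Ioo L U, MvPolynomial.eval ![s, β k s]
            (MvPolynomial.X 0 * MvPolynomial.pderiv 0 (MvPolynomial.X 0 * MvPolynomial.pderiv 0 Φ)
            * (MvPolynomial.X 1 * MvPolynomial.pderiv 1 Φ) ^ 2
          - 2 * (MvPolynomial.X 0 * MvPolynomial.pderiv 0 (MvPolynomial.X 1 * MvPolynomial.pderiv 1 Φ))
            * (MvPolynomial.X 0 * MvPolynomial.pderiv 0 Φ) * (MvPolynomial.X 1 * MvPolynomial.pderiv 1 Φ)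
          + MvPolynomial.X 1 * MvPolynomial.pderiv 1 (MvPolynomial.X 1 * MvPolynomial.pderiv 1 Φ)
            * (MvPolynomial.X 0 * MvPolynomial.pderiv 0 Φ) ^ 2) ≠ 0 := by
          intro s hs hH
          have hmem : (![s, β k s] : Fin 2 → ℝ) ∈ O k := by
            refine Finset.mem_filter.2 ⟨(Set.Finite.mem_toFinset hfin).2 ⟨?_, ?_, hsolk s hs, hH⟩, by simp⟩
            · simpa using hIoi s hs
            · simpa using hposk s hs
          exact hfree s (Finset.mem_union.2 (Or.inr (Finset.mem_image.2 ⟨_, hmem, by simp⟩))) hs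
        have hΦb : ∀ s ∈ Ioo L U, MvPolynomial.eval ![s, β k s] (pderiv 1 Φ) ≠ 0 := fun s hs h1 =>
          hnot_osc s hs (eval_logHessian_eq_zero_of_pderiv_one_eq_zero Φ P hP hsplit (hIoi s hs) (hsolk s hs) h1)
        have hD := hasDerivAt_of_solution_of_simple Φ hcontk hsolk hΦb
        have hE := card_roots_filter_branchArc_le_two Φ g c N hL (β k) (deriv (β k)) (deriv (deriv (β k))) hg
          (fun s hs => (hD s hs).1) (fun s hs => (hD s hs).2) hposk hsolk hΦb hnot_osc
        refine le_trans (Multiset.card_le_card ?_) hE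
        rw [hT, Multiset.filter_filter]
        refine Multiset.monotone_filter_right g.roots ?_
        intro t ⟨⟨h1, h2⟩, _, h4⟩
        exact ⟨h1, h2, h4⟩
  -- summing the cuts: zero ends, charged to `Z₊mult(a₀)` via the end cost
  have hZsum : ∑ k ∈ Finset.range m, (Z k).card ≤ Multiset.card ((a 0).roots.filter (fun t => 0 < t)) := by
    have hswap : ∑ k ∈ Finset.range m, (Z k).card =
        ∑ ω ∈ A, ((Finset.range m).filter (fun k => β k ω = 0)).card := by
      simp only [hZ, Finset.card_filter]
      rw [Finset.sum_comm]
    rw [hswap]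
    have hmult : ∀ ω ∈ A, ((Finset.range m).filter (fun k => β k ω = 0)).card ≤ (a 0).rootMultiplicity ω := by
      intro ω hω
      obtain ⟨-, hω0⟩ := Finset.mem_filter.1 hω
      have hcount : ((Finset.range m).filter (fun k => β k ω = 0)).card = (P ω).rootMultiplicity 0 := by
        rw [← count_roots, hroots ω hω0, Multiset.count_map, Finset.card_def, Finset.filter_val]
        exact congrArg _ (Multiset.filter_congr fun k _ => eq_comm)
      rw [hcount]
      exact Literature.Algebra.Polynomial.AKLM.rootMultiplicity_zero_le_rootMultiplicity_coeff m a hω0 hsplit ha0 (hP0 ω)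
    refine (Finset.sum_le_sum hmult).trans ?_
    have hA' : A = ((a 0).roots.filter (fun t => 0 < t)).toFinset := by
      rw [hA, Multiset.toFinset_filter]
    rw [hA', ← Multiset.toFinset_sum_count_eq ((a 0).roots.filter (fun t => 0 < t))]
    refine Finset.sum_le_sum fun ω hω => ?_
    have hω0 : 0 < ω := (Multiset.mem_filter.1 (Multiset.mem_toFinset.1 hω)).2
    rw [Multiset.count_filter_of_pos hω0, count_roots]
  -- summing the cuts: osculation points, each on at most `m` branches
  have hOsum : ∑ k ∈ Finset.range m, ((O k).image (fun p => p 0)).card ≤ m * {p : Fin 2 → ℝ | 0 < p 0 ∧ 0 < p 1 ∧ MvPolynomial.eval p Φ = 0 ∧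
      MvPolynomial.eval p
        (MvPolynomial.X 0 * MvPolynomial.pderiv 0 (MvPolynomial.X 0 * MvPolynomial.pderiv 0 Φ)
            * (MvPolynomial.X 1 * MvPolynomial.pderiv 1 Φ) ^ 2
          - 2 * (MvPolynomial.X 0 * MvPolynomial.pderiv 0 (MvPolynomial.X 1 * MvPolynomial.pderiv 1 Φ))
            * (MvPolynomial.X 0 * MvPolynomial.pderiv 0 Φ) * (MvPolynomial.X 1 * MvPolynomial.pderiv 1 Φ)
          + MvPolynomial.X 1 * MvPolynomial.pderiv 1 (MvPolynomial.X 1 * MvPolynomial.pderiv 1 Φ)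
            * (MvPolynomial.X 0 * MvPolynomial.pderiv 0 Φ) ^ 2) = 0}.ncard := by
    rw [Set.ncard_eq_toFinset_card _ hfin]
    calc ∑ k ∈ Finset.range m, ((O k).image (fun p => p 0)).card
        ≤ ∑ k ∈ Finset.range m, hfin.toFinset.card :=
          Finset.sum_le_sum fun k _ => Finset.card_image_le.trans (Finset.card_filter_le _ _)
      _ = m * hfin.toFinset.card := by rw [Finset.sum_const, Finset.card_range, smul_eq_mul]
  -- assembly
  calc Multiset.card M ≤ ∑ k ∈ Finset.range m, Multiset.card (T k) := hcover
    _ ≤ ∑ k ∈ Finset.range m, 2 * ((Z k ∪ (O k).image (fun p => p 0)).card + 1) :=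
        Finset.sum_le_sum fun k hk => hbranch k (Finset.mem_range.1 hk)
    _ ≤ ∑ k ∈ Finset.range m, 2 * ((Z k).card + ((O k).image (fun p => p 0)).card + 1) :=
        Finset.sum_le_sum fun k _ => Nat.mul_le_mul_left 2 (Nat.add_le_add_right (Finset.card_union_le _ _) 1)
    _ = 2 * (∑ k ∈ Finset.range m, (Z k).card) + 2 * (∑ k ∈ Finset.range m, ((O k).image (fun p => p 0)).card)
          + 2 * m := by
        rw [← Finset.mul_sum, Finset.sum_add_distrib, Finset.sum_add_distrib, Finset.sum_const, Finset.card_range,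
          smul_eq_mul, mul_one, mul_add, mul_add]
    _ ≤ 2 * Multiset.card ((a 0).roots.filter (fun t => 0 < t)) + 2 * (m * {p : Fin 2 → ℝ | 0 < p 0 ∧ 0 < p 1 ∧ MvPolynomial.eval p Φ = 0 ∧
      MvPolynomial.eval p
        (MvPolynomial.X 0 * MvPolynomial.pderiv 0 (MvPolynomial.X 0 * MvPolynomial.pderiv 0 Φ)
            * (MvPolynomial.X 1 * MvPolynomial.pderiv 1 Φ) ^ 2
          - 2 * (MvPolynomial.X 0 * MvPolynomial.pderiv 0 (MvPolynomial.X 1 * MvPolynomial.pderiv 1 Φ))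
            * (MvPolynomial.X 0 * MvPolynomial.pderiv 0 Φ) * (MvPolynomial.X 1 * MvPolynomial.pderiv 1 Φ)
          + MvPolynomial.X 1 * MvPolynomial.pderiv 1 (MvPolynomial.X 1 * MvPolynomial.pderiv 1 Φ)
            * (MvPolynomial.X 0 * MvPolynomial.pderiv 0 Φ) ^ 2) = 0}.ncard) + 2 * m := by
        gcongr
    _ = 2 * m * {p : Fin 2 → ℝ | 0 < p 0 ∧ 0 < p 1 ∧ MvPolynomial.eval p Φ = 0 ∧
      MvPolynomial.eval p
        (MvPolynomial.X 0 * MvPolynomial.pderiv 0 (MvPolynomial.X 0 * MvPolynomial.pderiv 0 Φ)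
            * (MvPolynomial.X 1 * MvPolynomial.pderiv 1 Φ) ^ 2
          - 2 * (MvPolynomial.X 0 * MvPolynomial.pderiv 0 (MvPolynomial.X 1 * MvPolynomial.pderiv 1 Φ))
            * (MvPolynomial.X 0 * MvPolynomial.pderiv 0 Φ) * (MvPolynomial.X 1 * MvPolynomial.pderiv 1 Φ)
          + MvPolynomial.X 1 * MvPolynomial.pderiv 1 (MvPolynomial.X 1 * MvPolynomial.pderiv 1 Φ)
            * (MvPolynomial.X 0 * MvPolynomial.pderiv 0 Φ) ^ 2) = 0}.ncard + 2 * m + 2 * Multiset.card ((a 0).roots.filter (fun t => 0 < t)) := by ring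

end OsculationPeel

end Summit.ValiantsHypothesis.ValiantsHypothesis.Theorems.LacunarySymmetroidMatrixDescartes

end
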